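import Summits.ResolutionOfSingularities.ResolutionOfSingularities.Theorems.MarkedTransferCampaignW46ExitTree
import Literature.AlgebraicGeometry.Resolution.QuadraticTransformsFactorization
import Literature.AlgebraicGeometry.Resolution.RegularLocalOrder
import HarnessLib

/-!
# The marked quadratic tree is finitely branching at a tame node

[OURS · L1 W4.6 rung (i-a)′, INVARIANT layer — cell res-hironaka, LADDER-RESOLUTION rung L, D-0089; campaign s46,
seat res-D-pv-044 AS res-L1-s46-pv-8; host route MarkedTransfer, `--supports stmt-ResolutionOfSingularities-16156
--as helper`.] HONEST FRAMING: nothing here is a statement of H. Hironaka's manuscript (2017-03-23, [Hironaka2017]);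
pure commutative algebra inside a field `K`, continuing `MarkedTransferCampaignW46ExitTree.lean`. AI-written; weaker
than expert review. No `sorry`; axioms standard.

Let `(S, 𝔪 = (x, y))` be a two-dimensional regular local ring of `K` and `J ⊆ S` an ideal of exact order `r` with
`b ≤ r < 2b` (a TAME node of the marked tree). At a two-dimensional first quadratic transform `S' ⊇ A = S[y/x]`,
`S' = A_Q`, the controlled transform is `(J S' : (𝔪 S')^b) = x^{r-b} · W S'` with `W = (JA : x^r)` the weak
transform on the chart, and `x` is a regular parameter of `S'` (`𝔪_{S'} = (x, f)`). Hence **if the controlled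
transform has order `≥ b` at `S'` then `W ⊆ Q`** (otherwise `x^{r-b} ∈ 𝔪_{S'}^b` with `r - b < b`), so `Q` is a
minimal prime over `W + xA` — and a Noetherian ring has finitely many of those (Zariski–Samuel II, App. 5: the
base points of `J` on the exceptional curve are finitely many; pattern = the tree's
`finite_setOf_isQuadraticTransform_not_isPrincipal`, `QuadraticTransformWeakTransform.lean`). PROVED:

* `exists_maximalIdeal_eq_span_pair_of_isQuadraticTransform` — `𝔪_{S'} = (x, f)` for a first quadratic transform
  `S' ⊇ S[y/x]` (Huneke–Swanson p. 264: the primes of `S[y/x]` over `x S[y/x]` are `(x, f)`);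
* `extIdeal_eq_span_pow_mul_map_weakTransform`, `extIdeal_maximalIdeal_eq_span`, `pow_mem_ctrlTransform_of_map_eq_top`
  — the controlled transform on the chart;
* `exists_minimalPrime_of_ctrlTransform_le` — the core statement above;
* `finite_setOf_isQuadraticTransform_ctrlTransform_le`, **`finite_setOf_markedStep_isSingularNode`** — a tame node
  has finitely many singular children in the marked tree.

## References

* O. Zariski, P. Samuel, *Commutative Algebra* II (1960), Appendix 5. [ZariskiSamuel1960]
* C. Huneke, I. Swanson, *Integral Closure of Ideals, Rings, and Modules* (2006), §14.2 (p. 264), Lemma 14.3.4.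
  [HunekeSwanson2006]
-/

noncomputable section

open IsLocalRing

-- single-problem summit: the doubled namespace component `ResolutionOfSingularities` is forced
set_option linter.dupNamespace false

namespace Summit.ResolutionOfSingularities.ResolutionOfSingularities.Theorems.CampaignW46

open Literature.AlgebraicGeometry.Resolution

universe u

variable {K : Type u} [Field K]

/-! ## The maximal ideal of a first quadratic transform -/

section Chart

variable {S : Subring K} [IsRegularLocalRing S] {x y : S}

/-- **`𝔪_{S'} = (x, f)` at a first quadratic transform** `S' ⊇ A = S[y/x]` of the two-dimensional regular local
ring `(S, 𝔪 = (x, y))`: `S' = A_Q` with `Q ⊇ xA = 𝔪 A`, the primes over `xA` are `(x, f)` (`A/xA ≅ k[X]`), and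
every element of `𝔪_{S'}` is a fraction `a/s` with `a ∈ Q`, `s ∈ A ∖ Q`. [cite: HunekeSwanson2006, §14.2 (p. 264)] -/
theorem exists_maximalIdeal_eq_span_pair_of_isQuadraticTransform
    (hm : maximalIdeal S = Ideal.span {x, y}) (hx0 : x ≠ 0) {S' : Subring K} [IsLocalRing S']
    (h₁ : IsQuadraticTransform S S') (hle : chartAdjoin (K := K) x y ≤ S') :
    ∃ f : S', maximalIdeal S' = Ideal.span {Subring.inclusion hle (chartIncl x y x), f} := by
  have hxm : x ∈ maximalIdeal S := hm ▸ Ideal.subset_span (by simp)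
  set A := chartAdjoin (K := K) x y with hAdef
  set Q : Ideal A := (maximalIdeal S').comap (Subring.inclusion hle) with hQdef
  haveI hQ : Q.IsPrime := Ideal.comap_isPrime _ _
  have hA : blowupRing S (x : K) = A := blowupRing_eq_adjoin hm
  have hR₁ : S' = (LocalSubring.ofPrime A Q).toSubring := h₁.eq_ofPrime_of_le hxm hx0 hA.le hle
  -- `𝔪_S A ≤ Q`, so `Q = (x, f)`
  have h𝔭Q : (maximalIdeal S).map (chartIncl (K := K) x y) ≤ Q := by
    rw [Ideal.map_le_iff_le_comap]
    intro r hr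
    rw [Ideal.mem_comap, hQdef, Ideal.mem_comap]
    exact (incl_mem_maximalIdeal_iff h₁.dominates r).mpr hr
  obtain ⟨f, hQf⟩ := exists_eq_span_pair_of_map_maximalIdeal_le hm hx0 rfl h𝔭Q
  refine ⟨Subring.inclusion hle f, le_antisymm ?_ ?_⟩
  · intro z hz
    -- `z = a / s`, `a ∈ A`, `s ∈ A ∖ Q`
    have hzL : (z : K) ∈ (LocalSubring.ofPrime A Q).toSubring := hR₁ ▸ z.2
    obtain ⟨a, s, hs, hz'⟩ := mem_ofPrime_iff.mp hzL
    have hs0 : ((s : A) : K) ≠ 0 := coe_ne_zero_of_not_mem hs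
    -- `s` is a unit of `S'`, `a ∈ Q`
    have hsu : IsUnit (Subring.inclusion hle s) := by
      have : Subring.inclusion hle s ∉ maximalIdeal S' := fun h => hs (Ideal.mem_comap.mpr h)
      exact IsLocalRing.notMem_maximalIdeal.mp this
    obtain ⟨u, hu⟩ := hsu
    have haQ : a ∈ Q := by
      rw [hQdef, Ideal.mem_comap]
      have e : Subring.inclusion hle a = z * Subring.inclusion hle s := by
        apply Subtype.ext
        change (a : K) = (z : K) * (s : K)
        rw [hz', div_mul_cancel₀ _ hs0]
      rw [e]
      exact Ideal.mul_mem_right _ _ hz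
    rw [hQf, Ideal.mem_span_pair] at haQ
    obtain ⟨α, β, hαβ⟩ := haQ
    -- `z = (α x + β f) / s`
    have hz1 : z = (Subring.inclusion hle α * ↑u⁻¹) * Subring.inclusion hle (chartIncl x y x) +
        (Subring.inclusion hle β * ↑u⁻¹) * Subring.inclusion hle f := by
      have e1 : z * Subring.inclusion hle s = Subring.inclusion hle a := by
        apply Subtype.ext
        change (z : K) * (s : K) = (a : K)
        rw [hz', div_mul_cancel₀ _ hs0]
      have e2 : z = Subring.inclusion hle a * ↑u⁻¹ := by
        rw [← e1, ← hu, mul_assoc, Units.mul_inv, mul_one]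
      rw [e2, ← hαβ, map_add, map_mul, map_mul]
      ring
    rw [hz1]
    exact Ideal.add_mem _ (Ideal.mul_mem_left _ _ (Ideal.subset_span (by simp)))
      (Ideal.mul_mem_left _ _ (Ideal.subset_span (by simp)))
  · rw [Ideal.span_le]
    have hxQ : chartIncl (K := K) x y x ∈ Q := hQf ▸ Ideal.subset_span (by simp)
    have hfQ : f ∈ Q := hQf ▸ Ideal.subset_span (by simp)
    rintro z (rfl | hz)
    · exact Ideal.mem_comap.mp hxQ
    · rw [Set.mem_singleton_iff] at hz
      subst hz
      exact Ideal.mem_comap.mp hfQ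

/-! ## The controlled transform on the chart of `x` -/

variable {b : ℕ}

/-- `J S' = x^r · W S'` for `J ⊆ 𝔪^r`, `W = (JA : x^r)` the weak transform on the chart `A = S[y/x] ⊆ S'`.
[cite: HunekeSwanson2006, Lemma 14.3.4] -/
theorem extIdeal_eq_span_pow_mul_map_weakTransform (hm : maximalIdeal S = Ideal.span {x, y})
    (hx0 : x ≠ 0) {J : Ideal S} {r : ℕ} (hJ : J ≤ maximalIdeal S ^ r) {S' : Subring K}
    (hle : chartAdjoin (K := K) x y ≤ S') :
    extIdeal J S' = Ideal.span {Subring.inclusion hle (chartIncl x y x) ^ r} *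
      (weakTransformChart x y J r).map (Subring.inclusion hle) := by
  have hSS' : S ≤ S' := (subring_le_adjoin S _).trans hle
  have hcomp : (Subring.inclusion hle).comp (chartIncl (K := K) x y) = Subring.inclusion hSS' :=
    RingHom.ext fun _ => rfl
  rw [extIdeal_eq_map J hSS', ← hcomp, ← Ideal.map_map, map_eq_span_pow_mul_weakTransform hm hx0 hJ,
    Ideal.map_mul, Ideal.map_span, Set.image_singleton, map_pow]

/-- `𝔪_S S' = x S'` on the chart of `x`. [cite: HunekeSwanson2006, §14.2 (p. 264)] -/
theorem extIdeal_maximalIdeal_eq_span (hm : maximalIdeal S = Ideal.span {x, y}) (hx0 : x ≠ 0)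
    {S' : Subring K} (hle : chartAdjoin (K := K) x y ≤ S') :
    extIdeal (maximalIdeal S) S' = Ideal.span {Subring.inclusion hle (chartIncl x y x)} := by
  have hSS' : S ≤ S' := (subring_le_adjoin S _).trans hle
  have hcomp : (Subring.inclusion hle).comp (chartIncl (K := K) x y) = Subring.inclusion hSS' :=
    RingHom.ext fun _ => rfl
  rw [extIdeal_eq_map _ hSS', ← hcomp, ← Ideal.map_map, map_maximalIdeal_chartIncl hm hx0,
    Ideal.map_span, Set.image_singleton]

/-- If the weak transform generates the unit ideal of `S'` then `x^{r-b}` lies in the controlled transform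
`(J S' : (𝔪 S')^b) = (x^r S' : x^b S')` (`b ≤ r`). [folklore] -/
theorem pow_mem_ctrlTransform_of_map_eq_top (hm : maximalIdeal S = Ideal.span {x, y}) (hx0 : x ≠ 0)
    {J : Ideal S} {r : ℕ} (hJ : J ≤ maximalIdeal S ^ r) (hbr : b ≤ r) {S' : Subring K}
    (hle : chartAdjoin (K := K) x y ≤ S')
    (htop : (weakTransformChart x y J r).map (Subring.inclusion hle) = ⊤) :
    Subring.inclusion hle (chartIncl x y x) ^ (r - b) ∈ ctrlTransform b S J S' := by
  rw [ctrlTransform, extIdeal_eq_span_pow_mul_map_weakTransform hm hx0 hJ hle, htop, Ideal.mul_top,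
    extIdeal_maximalIdeal_eq_span hm hx0 hle, Ideal.span_singleton_pow]
  refine Submodule.mem_colon.mpr fun s hs => ?_
  obtain ⟨c, rfl⟩ := Ideal.mem_span_singleton'.mp hs
  rw [smul_eq_mul, show Subring.inclusion hle (chartIncl x y x) ^ (r - b) *
      (c * Subring.inclusion hle (chartIncl x y x) ^ b) =
    c * Subring.inclusion hle (chartIncl x y x) ^ r by
      rw [mul_left_comm, ← pow_add, Nat.sub_add_cancel hbr]]
  exact Ideal.mul_mem_left _ _ (Ideal.mem_span_singleton_self _)

/-- **A singular child in the chart of `x` lies over a minimal prime of `W + xA`.** For a tame node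
(`J` of exact order `r`, `b ≤ r < 2b`) and a two-dimensional regular first quadratic transform `S' ⊇ S[y/x]` at
which the controlled transform has order `≥ b`, `S'` is the local ring of `A = S[y/x]` at a minimal prime over
`(JA : x^r) + xA`: with `S' = A_Q`, if `W = (JA : x^r) ⊄ Q` then `W S' = S'`, `x^{r-b} ∈ (J S' : x^b S') ⊆ 𝔪_{S'}^b`,
impossible since `x ∉ 𝔪_{S'}^2` and `r - b < b`; and no prime lies strictly between `xA` and `Q`.
[cite: ZariskiSamuel1960, Appendix 5] -/
theorem exists_minimalPrime_of_ctrlTransform_le (hdim : ringKrullDim S = 2)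
    (hm : maximalIdeal S = Ideal.span {x, y}) (hx0 : x ≠ 0) (hpq : ∀ t, x ∣ y * t → x ∣ t)
    {J : Ideal S} {r : ℕ} (hJ : J ≤ maximalIdeal S ^ r) (hJr : ¬ J ≤ maximalIdeal S ^ (r + 1))
    (hbr : b ≤ r) (hr2 : r < 2 * b)
    {S' : Subring K} [IsRegularLocalRing S'] (h₁ : IsQuadraticTransform S S')
    (hd' : ringKrullDim S' = 2) (hle : chartAdjoin (K := K) x y ≤ S')
    (hsing : ctrlTransform b S J S' ≤ maximalIdeal S' ^ b) :
    ∃ Q ∈ (weakTransformChart (K := K) x y J r ⊔ Ideal.span {chartIncl x y x}).minimalPrimes,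
      ∃ _ : Q.IsPrime, S' = (LocalSubring.ofPrime (chartAdjoin (K := K) x y) Q).toSubring := by
  have hxm : x ∈ maximalIdeal S := hm ▸ Ideal.subset_span (by simp)
  have hym : y ∈ maximalIdeal S := hm ▸ Ideal.subset_span (by simp)
  set A := chartAdjoin (K := K) x y with hAdef
  set Q : Ideal A := (maximalIdeal S').comap (Subring.inclusion hle) with hQdef
  have hA : blowupRing S (x : K) = A := blowupRing_eq_adjoin hm
  have hR₁ : S' = (LocalSubring.ofPrime A Q).toSubring := h₁.eq_ofPrime_of_le hxm hx0 hA.le hle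
  -- the exceptional prime `𝔭 = xA ≤ Q`
  haveI h𝔭 : (Ideal.span {chartIncl (K := K) x y x}).IsPrime := by
    rw [← map_maximalIdeal_chartIncl hm hx0]
    exact isPrime_map_incl (K := K) hx0 hpq hxm hym
  have h𝔭Q : Ideal.span {chartIncl (K := K) x y x} ≤ Q := by
    rw [Ideal.span_singleton_le_iff_mem, hQdef, Ideal.mem_comap]
    exact (incl_mem_maximalIdeal_iff h₁.dominates x).mpr hxm
  -- `W ≤ Q`: else `x^{r-b} ∈ 𝔪_{S'}^b`
  set W := weakTransformChart (K := K) x y J r with hWdef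
  have hWQ : W ≤ Q := by
    by_contra hnot
    obtain ⟨w, hwW, hwQ⟩ := Set.not_subset.mp hnot
    have htop : W.map (Subring.inclusion hle) = ⊤ := by
      refine Ideal.eq_top_of_isUnit_mem _ (Ideal.mem_map_of_mem _ hwW) ?_
      have hw' : Subring.inclusion hle w ∉ maximalIdeal S' := fun h => hwQ (Ideal.mem_comap.mpr h)
      exact IsLocalRing.notMem_maximalIdeal.mp hw'
    have hmem : Subring.inclusion hle (chartIncl x y x) ^ (r - b) ∈ maximalIdeal S' ^ b :=
      hsing (pow_mem_ctrlTransform_of_map_eq_top hm hx0 hJ hbr hle htop)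
    -- `x ∉ 𝔪_{S'}^2`
    obtain ⟨f, hm'⟩ := exists_maximalIdeal_eq_span_pair_of_isQuadraticTransform hm hx0 h₁ hle
    have hx2 : Subring.inclusion hle (chartIncl x y x) ∉ maximalIdeal S' ^ 2 := fst_not_mem_sq hd' hm'
    have hpow := pow_not_mem_pow_of_not_mem_pow (p := 1) hx2 (r - b)
    rw [mul_one] at hpow
    exact hpow (Ideal.pow_le_pow_right (by omega) hmem)
  -- `Q` is minimal over `W + xA`
  have hWx : ¬ W ≤ Ideal.span {chartIncl (K := K) x y x} :=
    weakTransform_not_le_span hdim hm hx0 hJ hJr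
  refine ⟨Q, ⟨⟨inferInstance, sup_le hWQ h𝔭Q⟩, fun P ⟨hP, hIP⟩ hPQ => ?_⟩, inferInstance, hR₁⟩
  haveI := hP
  have h𝔭P : Ideal.span {chartIncl (K := K) x y x} < P := by
    refine lt_of_le_of_ne (le_sup_right.trans hIP) fun heq => hWx ?_
    rw [heq]; exact le_sup_left.trans hIP
  exact (eq_of_span_lt_of_le hdim hx0 h𝔭 h𝔭P hPQ).ge

/-- **Only finitely many two-dimensional regular first quadratic transforms carry a controlled transform of
order `≥ b`** (tame node: `J` of exact order `r`, `b ≤ r < 2b`; `𝔪 = (x, y)` a good pair of parameters): each lies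
in the chart of `x` or of `y` over a minimal prime of `W + (chart element)`. [cite: ZariskiSamuel1960, Appendix 5] -/
theorem finite_setOf_isQuadraticTransform_ctrlTransform_le (hdim : ringKrullDim S = 2)
    (hm : maximalIdeal S = Ideal.span {x, y}) (hx0 : x ≠ 0) (hy0 : y ≠ 0)
    (hpq : ∀ t, x ∣ y * t → x ∣ t) (hqp : ∀ t, y ∣ x * t → y ∣ t)
    {J : Ideal S} {r : ℕ} (hJ : J ≤ maximalIdeal S ^ r) (hJr : ¬ J ≤ maximalIdeal S ^ (r + 1))
    (hbr : b ≤ r) (hr2 : r < 2 * b) :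
    {S' : Subring K | ∃ (_ : IsRegularLocalRing S'), IsQuadraticTransform S S' ∧
      ringKrullDim S' = 2 ∧ ctrlTransform b S J S' ≤ maximalIdeal S' ^ b}.Finite := by
  classical
  have hm' : maximalIdeal S = Ideal.span {y, x} := by rw [hm, Set.pair_comm]
  let fx : Ideal (chartAdjoin (K := K) x y) → Subring K := fun Q =>
    if h : Q.IsPrime then (@LocalSubring.ofPrime K _ (chartAdjoin (K := K) x y) Q h).toSubring else ⊥
  let fy : Ideal (chartAdjoin (K := K) y x) → Subring K := fun Q =>
    if h : Q.IsPrime then (@LocalSubring.ofPrime K _ (chartAdjoin (K := K) y x) Q h).toSubring else ⊥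
  haveI : IsNoetherianRing (chartAdjoin (K := K) x y) := isNoetherianRing_adjoin_toSubring S _
  haveI : IsNoetherianRing (chartAdjoin (K := K) y x) := isNoetherianRing_adjoin_toSubring S _
  have hfinx := (Ideal.finite_minimalPrimes_of_isNoetherianRing _
    (weakTransformChart (K := K) x y J r ⊔ Ideal.span {chartIncl x y x})).image fx
  have hfiny := (Ideal.finite_minimalPrimes_of_isNoetherianRing _
    (weakTransformChart (K := K) y x J r ⊔ Ideal.span {chartIncl y x y})).image fy
  refine (hfinx.union hfiny).subset ?_
  rintro S' ⟨hreg, h₁, hd', hsing⟩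
  rcases h₁.blowupRing_le_or hm with hX | hY
  · left
    have hle : chartAdjoin (K := K) x y ≤ S' := (blowupRing_eq_adjoin (K := K) hm).symm.le.trans hX
    obtain ⟨Q, hQmin, hQp, hR₁⟩ :=
      exists_minimalPrime_of_ctrlTransform_le hdim hm hx0 hpq hJ hJr hbr hr2 h₁ hd' hle hsing
    refine ⟨Q, hQmin, ?_⟩
    simp only [fx, dif_pos hQp]
    exact hR₁.symm
  · right
    have hle : chartAdjoin (K := K) y x ≤ S' := (blowupRing_eq_adjoin (K := K) hm').symm.le.trans hY
    obtain ⟨Q, hQmin, hQp, hR₁⟩ :=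
      exists_minimalPrime_of_ctrlTransform_le hdim hm' hy0 hqp hJ hJr hbr hr2 h₁ hd' hle hsing
    refine ⟨Q, hQmin, ?_⟩
    simp only [fy, dif_pos hQp]
    exact hR₁.symm

end Chart

/-! ## Finite branching of the marked tree -/

/-- **A node of the marked tree has finitely many singular children**: out of a non-tame node there is no step;
a tame node `(S, J)` (`J` of exact order `r`, `b ≤ r < 2b`) has finitely many two-dimensional first quadratic
transforms at which the controlled transform keeps order `≥ b` (`finite_setOf_isQuadraticTransform_ctrlTransform_le`
for a good regular system of parameters, `exists_maximalIdeal_eq_span_pair`). [cite: ZariskiSamuel1960, Appendix 5] -/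
theorem finite_setOf_markedStep_isSingularNode (b : ℕ) (n₀ : MarkedNode K) :
    {n : MarkedNode K | MarkedStep b n₀ n ∧ IsSingularNode b n}.Finite := by
  classical
  by_cases ht : IsTameNode b n₀
  swap
  · refine Set.finite_empty.subset ?_
    rintro n ⟨hs, -⟩
    exact ht hs.isTameNode
  obtain ⟨S, J⟩ := n₀
  obtain ⟨hreg, hdim, -, hJb, hJ2b⟩ := ht
  haveI := hreg
  -- the exact order `r` of `J`: `b ≤ r < 2b`
  have hb : 0 < b := by
    rcases Nat.eq_zero_or_pos b with h0 | h0
    · exfalso; apply hJ2b; rw [h0, mul_zero, pow_zero, Ideal.one_eq_top]; exact le_top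
    · exact h0
  have hex : ∃ k, ¬ J ≤ maximalIdeal S ^ (k + 1) :=
    ⟨2 * b - 1, by rwa [show 2 * b - 1 + 1 = 2 * b by omega]⟩
  set r := Nat.find hex with hrdef
  have hJr : ¬ J ≤ maximalIdeal S ^ (r + 1) := Nat.find_spec hex
  have hbr : b ≤ r := by
    by_contra hlt
    push Not at hlt
    exact hJr (hJb.trans (Ideal.pow_le_pow_right (show r + 1 ≤ b by omega)))
  have hr2 : r < 2 * b := by
    by_contra hge
    push Not at hge
    have := Nat.find_min hex (show 2 * b - 1 < r by omega)
    push Not at this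
    apply hJ2b
    rwa [show 2 * b - 1 + 1 = 2 * b by omega] at this
  have hJ : J ≤ maximalIdeal S ^ r := by
    rcases Nat.eq_zero_or_pos r with h0 | hpos
    · rw [h0, pow_zero, Ideal.one_eq_top]; exact le_top
    · have := Nat.find_min hex (show r - 1 < r by omega)
      push Not at this
      rwa [show r - 1 + 1 = r by omega] at this
  -- a good regular system of parameters
  obtain ⟨u, v, huv, hup, hvp, huv', hvu'⟩ := exists_maximalIdeal_eq_span_pair hdim
  have hu0 : u ≠ 0 := hup.ne_zero
  have hv0 : v ≠ 0 := hvp.ne_zero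
  have hpq : ∀ t, u ∣ v * t → u ∣ t := fun t ht => (hup.dvd_or_dvd ht).resolve_left huv'
  have hqp : ∀ t, v ∣ u * t → v ∣ t := fun t ht => (hvp.dvd_or_dvd ht).resolve_left hvu'
  have hfin := finite_setOf_isQuadraticTransform_ctrlTransform_le (K := K) hdim huv hu0 hv0 hpq hqp
    hJ hJr hbr hr2
  refine (hfin.image (childNode b S J)).subset ?_
  rintro n ⟨hstep, hsing⟩
  obtain ⟨S', J'⟩ := n
  obtain ⟨-, _, h₁, hd', hJ'⟩ := hstep
  obtain ⟨hreg', -, -, hle'⟩ := hsing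
  dsimp only at h₁ hd' hJ' hreg' hle'
  subst hJ'
  exact ⟨S', ⟨hreg', h₁, hd', hle'⟩, rfl⟩

end Summit.ResolutionOfSingularities.ResolutionOfSingularities.Theorems.CampaignW46

end
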